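import Mathlib
import HarnessLib
import Literature.MathematicalPhysics.StatisticalMechanics.GaussianWeightStep
import Literature.Probability.Distributions.GaussianQuadraticTilt
import Literature.Analysis.Matrix.RegulatorRenormalisation

/-!
# The next-scale weight form is the renormalised regulator `A(1 − CA)⁻¹`
# (Adams–Buchholz–Kotecký–Müller (7.5) ↔ the tree's regulator-renormalisation algebra)

`GaussianWeightStep.lean` defines the invertibility-free next-scale form of [ABKM19] (7.5),
`nextForm A C = A + A√C(1 − √CA√C)⁻¹√CA`, and proves the Gaussian step (7.8) and the integration
property bound with it.  The tree's regulator library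
(`Literature/Probability/Distributions/GaussianQuadraticTilt.lean`,
`Literature/Analysis/Matrix/RegulatorRenormalisation.lean`, `…/RegulatorSubcriticality.lean`) works
with the RENORMALISED REGULATOR `M(1 − CM)⁻¹` and its flow `regFlow` (tower / finite-range
factorisation / subcriticality propagation).  This file identifies the two:

* `nextForm_eq_mul_inv` — for `C ⪰ 0` and `1 − √C A √C` invertible,
  `nextForm A C = A (1 − C A)⁻¹` (push-through identity `add_mul_inv_mul_eq_mul_inv_one_sub`);
* `det_one_sub_sqrt_mul_sqrt_eq` — `det(1 − √C A √C) = det(1 − C A)`,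

so that every algebraic fact about `regFlow` (e.g. `prod_det_regFlow`, `renorm_renorm`,
`renorm_add_of_mul_mul_eq_zero`) applies to the weights `A_{k:k+1}^X` of [ABKM19] (7.5); as a first
instance, `nextForm_add_of_mul_mul_eq_zero` / `exp_nextForm_add_of_mul_mul_eq_zero` — the
finite-range FACTORISATION of the next-scale weight over components not interacting through `C`
([ABKM19] Theorem 7.1 (w4)).
Everything is proved; no named fact.

## References
* S. Adams, S. Buchholz, R. Kotecký, S. Müller, arXiv:1910.13564, Ch. 7.1 (7.5)
  [AdamsBuchholzKoteckyMuller2019].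
-/

noncomputable section

open Matrix
open scoped Matrix MatrixOrder

namespace Literature.MathematicalPhysics.StatisticalMechanics.GradientRG

open Literature.Probability.Distributions

variable {ι : Type*} [Fintype ι] [DecidableEq ι]

/-- `√C √C = C` for a positive semidefinite real matrix (`CFC.sqrt`).
[cite: AdamsBuchholzKoteckyMuller2019, Ch. 7.1 (7.8) (the operator C^{1/2})] -/
theorem sqrt_mul_sqrt_of_posSemidef {C : Matrix ι ι ℝ} (hC : C.PosSemidef) :
    CFC.sqrt C * CFC.sqrt C = C :=
  CFC.sqrt_mul_sqrt_self C hC.nonneg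

/-- **`det(1 − √C A √C) = det(1 − C A)`** for `C ⪰ 0`.
[cite: AdamsBuchholzKoteckyMuller2019, Ch. 7.1 (7.8) (first form of the prefactor)] -/
theorem det_one_sub_sqrt_mul_sqrt_eq {C : Matrix ι ι ℝ} (hC : C.PosSemidef) (A : Matrix ι ι ℝ) :
    ((1 : Matrix ι ι ℝ) - CFC.sqrt C * A * CFC.sqrt C).det = ((1 : Matrix ι ι ℝ) - C * A).det :=
  det_one_sub_sqrt_mul_sqrt (sqrt_mul_sqrt_of_posSemidef hC) A

/-- **The next-scale form is the renormalised regulator**: for `C ⪰ 0` and `1 − √C A √C`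
invertible, `nextForm A C = A (1 − C A)⁻¹` — [ABKM19] (7.5)'s `((A)⁻¹ − C)⁻¹` in the form of the
tree's `RegulatorRenormalisation` (`M(1 − CM)⁻¹`).
[cite: AdamsBuchholzKoteckyMuller2019, Ch. 7.1 (7.5)] -/
theorem nextForm_eq_mul_inv {C : Matrix ι ι ℝ} (hC : C.PosSemidef) {A : Matrix ι ι ℝ}
    (hU : IsUnit ((1 : Matrix ι ι ℝ) - CFC.sqrt C * A * CFC.sqrt C).det) :
    nextForm A C = A * ((1 : Matrix ι ι ℝ) - C * A)⁻¹ := by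
  unfold nextForm
  exact add_mul_inv_mul_eq_mul_inv_one_sub (sqrt_mul_sqrt_of_posSemidef hC) hU

/-- With a positive definite `1 − √C A √C` (the hypothesis of the Gaussian step) the identification
holds. [cite: AdamsBuchholzKoteckyMuller2019, Ch. 7.1 (7.5)] -/
theorem nextForm_eq_mul_inv_of_posDef {C : Matrix ι ι ℝ} (hC : C.PosSemidef) {A : Matrix ι ι ℝ}
    (hCA : ((1 : Matrix ι ι ℝ) - CFC.sqrt C * A * CFC.sqrt C).PosDef) :
    nextForm A C = A * ((1 : Matrix ι ι ℝ) - C * A)⁻¹ :=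
  nextForm_eq_mul_inv hC ((Matrix.isUnit_iff_isUnit_det _).1 hCA.isUnit)

/-! ## Finite-range factorisation of the next-scale form ([ABKM19] Theorem 7.1 (w4), Lemma 7.4) -/

/-- **The next-scale form is additive over components that do not interact through `C`**
(the mechanism of [ABKM19] Theorem 7.1 (w4): `w_{k:k+1}^{X∪Y} = w_{k:k+1}^X w_{k:k+1}^Y` for
`dist(X,Y) ≥ ¾L^{k+1}`, i.e. beyond the range of `C_{k+1}`): for `C ⪰ 0`, symmetric `A_X, A_Y` with
`A_X C A_Y = 0` and the three subcriticality determinants non-zero,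
`nextForm (A_X + A_Y) C = nextForm A_X C + nextForm A_Y C`.
[cite: AdamsBuchholzKoteckyMuller2019, Theorem 7.1 (w4)] -/
theorem nextForm_add_of_mul_mul_eq_zero {C : Matrix ι ι ℝ} (hC : C.PosSemidef) {X Y : Matrix ι ι ℝ}
    (hX : X.IsSymm) (hY : Y.IsSymm) (hXY : X * C * Y = 0)
    (hUX : IsUnit ((1 : Matrix ι ι ℝ) - CFC.sqrt C * X * CFC.sqrt C).det)
    (hUY : IsUnit ((1 : Matrix ι ι ℝ) - CFC.sqrt C * Y * CFC.sqrt C).det)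
    (hUXY : IsUnit ((1 : Matrix ι ι ℝ) - CFC.sqrt C * (X + Y) * CFC.sqrt C).det) :
    nextForm (X + Y) C = nextForm X C + nextForm Y C := by
  have hCT : Cᵀ = C := by
    have h := hC.1
    rwa [Matrix.IsHermitian, Matrix.conjTranspose_eq_transpose_of_trivial] at h
  have hYX : Y * C * X = 0 := Literature.Analysis.Matrix.mul_mul_eq_zero_symm hCT hX hY hXY
  have hUX' : IsUnit ((1 : Matrix ι ι ℝ) - C * X).det := by
    rwa [← det_one_sub_sqrt_mul_sqrt_eq hC]
  have hUY' : IsUnit ((1 : Matrix ι ι ℝ) - C * Y).det := by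
    rwa [← det_one_sub_sqrt_mul_sqrt_eq hC]
  rw [nextForm_eq_mul_inv hC hUXY, nextForm_eq_mul_inv hC hUX, nextForm_eq_mul_inv hC hUY]
  exact Literature.Analysis.Matrix.renorm_add_of_mul_mul_eq_zero hXY hYX hUX' hUY'

/-- Hence the next-scale Gaussian weight FACTORISES over non-interacting components:
`e^{½φᵀN(A_X+A_Y)φ} = e^{½φᵀN(A_X)φ} · e^{½φᵀN(A_Y)φ}` (`N = nextForm · C`).
[cite: AdamsBuchholzKoteckyMuller2019, Theorem 7.1 (w4)] -/
theorem exp_nextForm_add_of_mul_mul_eq_zero {C : Matrix ι ι ℝ} (hC : C.PosSemidef)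
    {X Y : Matrix ι ι ℝ} (hX : X.IsSymm) (hY : Y.IsSymm) (hXY : X * C * Y = 0)
    (hUX : IsUnit ((1 : Matrix ι ι ℝ) - CFC.sqrt C * X * CFC.sqrt C).det)
    (hUY : IsUnit ((1 : Matrix ι ι ℝ) - CFC.sqrt C * Y * CFC.sqrt C).det)
    (hUXY : IsUnit ((1 : Matrix ι ι ℝ) - CFC.sqrt C * (X + Y) * CFC.sqrt C).det) (φ : ι → ℝ) :
    Real.exp ((1/2 : ℝ) * (φ ⬝ᵥ nextForm (X + Y) C *ᵥ φ)) =
      Real.exp ((1/2 : ℝ) * (φ ⬝ᵥ nextForm X C *ᵥ φ)) *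
        Real.exp ((1/2 : ℝ) * (φ ⬝ᵥ nextForm Y C *ᵥ φ)) := by
  rw [nextForm_add_of_mul_mul_eq_zero hC hX hY hXY hUX hUY hUXY, Matrix.add_mulVec, dotProduct_add,
    mul_add, Real.exp_add]

end Literature.MathematicalPhysics.StatisticalMechanics.GradientRG

end
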